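import Summits.NavierStokesRegularity.NavierStokesRegularity.Theorems.TerminalTraceTypeITraceScarL3DepthEnstrophyFloor
import Summits.NavierStokesRegularity.NavierStokesRegularity.Theorems.TerminalTraceTypeITraceScarL3DepthUniformBounds
import HarnessLib

/-!
# Depth vorticity rigidity, part 7 — the CENTRE ENSTROPHY FLOOR ON A TIME INTERVAL at unit scale
# (stub `stub_centreEnstrophyAtDepth` of line `annulus-dichotomy` v4 at `T₁ = 1`) — helper for item
# `TerminalTrace.TypeITraceScarL3` (stmt-NavierStokesRegularity-18385)

Seat nsreg-C26-p1 (prover), `--supports stmt-NavierStokesRegularity-18385`; planner of record nsreg-p2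
g28, ROUND-26 §1c (Q1) and skeleton v4 (`stub_centreEnstrophyAtDepth`).

* `centreEnstrophyAtDepth_unit` — for every class `(M, D₀, C)` there are `κ > 0` and `c₂ ∈ ]0, ½[`
  such that every `(U, P, G)` — suitable in every `Q(a)`, weak gradient, `𝐈 ≤ M`, plain pressure bound
  `D ≤ D₀` at apices `≤ 0`, rate `C/√(−s)` — which is backward-singular at the origin admits
  `t₁ ∈ [−1, −½]` with `∫_{B(0,1)} |curl V(t)|² ≥ κ` for ALL `t ∈ [t₁ − c₂, t₁]` and EVERY continuous
  representative `V` of `U` on `]−2, −¼[ × ℝ³`.  Ingredients: the `L¹` space–time floor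
  `exists_depth_vorticity_floor` (file `…DepthEnstrophyFloor`), converted to an `L²` floor by
  `2λ|ω| − λ² ≤ |ω|²`; the class-uniform bounds `exists_uniform_strip_bound` and the time-Lipschitz
  enstrophy `abs_enstrophy_sub_le` (file `…DepthUniformBounds`); the maximum of the continuous enstrophy
  on `[−1, −½]` dominates its mean.

WHAT THIS IS NOT: not yet the registered stub (the parabolic rescaling to all `T₁` is the next file),
not item 18385, no statement about Navier–Stokes regularity.  [folklore; Tao2021 §5 (5.3)–(5.6)]
-/

noncomputable section

set_option linter.dupNamespace false

namespace Summit.NavierStokesRegularity.NavierStokesRegularity.Theorems.TypeITraceScarL3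

open MeasureTheory Set Function Filter Topology TopologicalSpace Metric InnerProductSpace
open Literature.Analysis Literature.Analysis.FluidPDE
open scoped NNReal ENNReal RealInnerProductSpace

/-- **Centre enstrophy floor on a time interval, unit scale.**  See the module docstring.
[folklore; Tao2021 §5 (5.3)–(5.6); EscauriazaSereginSverak2003 §3] -/
theorem centreEnstrophyAtDepth_unit (M D₀ : ℝ≥0) (C : ℝ) :
    ∃ κ : ℝ, 0 < κ ∧ ∃ c₂ : ℝ, 0 < c₂ ∧ c₂ < 1 / 2 ∧
    ∀ (U : ℝ → EuclideanSpace ℝ (Fin 3) → EuclideanSpace ℝ (Fin 3))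
      (P : ℝ → EuclideanSpace ℝ (Fin 3) → ℝ)
      (G : ℝ → EuclideanSpace ℝ (Fin 3) → EuclideanSpace ℝ (Fin 3) →L[ℝ] EuclideanSpace ℝ (Fin 3)),
      (∀ a : ℝ, 0 < a →
        IsSuitableWeakSolutionInBall a (0 : ℝ × EuclideanSpace ℝ (Fin 3)) U P) →
      (∀ a : ℝ, 0 < a →
        HasWeakSpatialGradientOn
          (parabolicCylinderOpens a (0 : ℝ × EuclideanSpace ℝ (Fin 3))) U G) →
      (∀ a : ℝ, 0 < a →
        typeIBound (parabolicCylinder a (0 : ℝ × EuclideanSpace ℝ (Fin 3))) U P G ≤ M) →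
      (∀ z₀ : ℝ × EuclideanSpace ℝ (Fin 3), z₀.1 ≤ 0 →
        ∀ r : ℝ, 0 < r → cknD r z₀ P ≤ D₀) →
      (∀ s : ℝ, s < 0 →
        ∀ᵐ y : EuclideanSpace ℝ (Fin 3), ‖U s y‖ ≤ C / Real.sqrt (-s)) →
      IsBackwardSingularPoint U (0 : ℝ × EuclideanSpace ℝ (Fin 3)) →
      ∃ t₁ ∈ Icc (-1 : ℝ) (-1 / 2),
        ∀ V : ℝ → EuclideanSpace ℝ (Fin 3) → EuclideanSpace ℝ (Fin 3),
          uncurry V =ᵐ[volume.restrict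
              (Ioo (-2 : ℝ) (-1 / 4) ×ˢ (univ : Set (EuclideanSpace ℝ (Fin 3))))] uncurry U →
          ContinuousOn (uncurry V)
            (Ioo (-2 : ℝ) (-1 / 4) ×ˢ (univ : Set (EuclideanSpace ℝ (Fin 3)))) →
          ∀ t ∈ Icc (t₁ - c₂) t₁,
            κ ≤ ∫ x in ball (0 : EuclideanSpace ℝ (Fin 3)) 1, ‖curl (V t) x‖ ^ 2 := by
  -- ### the class constants
  obtain ⟨κ₀, hκ₀, hfloor⟩ := exists_depth_vorticity_floor M C
  set L : ℝ := |C| / Real.sqrt (-(-1 / 4 : ℝ)) with hLdef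
  obtain ⟨K, hKunif⟩ := exists_uniform_strip_bound L D₀
  set O : Set (ℝ × EuclideanSpace ℝ (Fin 3)) :=
    Ioo (-1 : ℝ) (-1 / 2) ×ˢ ball (0 : EuclideanSpace ℝ (Fin 3)) 1 with hOdef
  have hOo : IsOpen O := isOpen_Ioo.prod isOpen_ball
  have hOm : MeasurableSet O := hOo.measurableSet
  have hOvol : volume O < ⊤ := by
    rw [hOdef, Measure.volume_eq_prod, Measure.prod_prod]
    exact ENNReal.mul_lt_top measure_Ioo_lt_top measure_ball_lt_top
  have hOvol0 : 0 < volume O := hOo.measure_pos volume ⟨((-3 / 4 : ℝ), 0), ⟨by norm_num, by norm_num⟩,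
    mem_ball_self one_pos⟩
  set vol : ℝ := (volume O).toReal with hvoldef
  have hvol0 : 0 < vol := ENNReal.toReal_pos hOvol0.ne' hOvol.ne
  set κ₁ : ℝ := κ₀ ^ 2 / vol with hκ₁def
  have hκ₁0 : 0 < κ₁ := by positivity
  set Λ : ℝ := 2 * (‖curlCLM‖ * K) * (‖curlCLM‖ * K * (3 + 2 * K)) *
    (volume (ball (0 : EuclideanSpace ℝ (Fin 3)) 1)).toReal with hΛdef
  set c₂ : ℝ := min (1 / 4) (κ₁ / (|Λ| + 1)) with hc₂def
  have hc₂0 : 0 < c₂ := lt_min (by norm_num) (by positivity)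
  have hc₂1 : c₂ ≤ 1 / 4 := min_le_left _ _
  have hc₂Λ : |Λ| * c₂ ≤ κ₁ := by
    have h1 : c₂ ≤ κ₁ / (|Λ| + 1) := min_le_right _ _
    have h2 : |Λ| * c₂ ≤ |Λ| * (κ₁ / (|Λ| + 1)) := mul_le_mul_of_nonneg_left h1 (abs_nonneg _)
    have h3 : |Λ| * (κ₁ / (|Λ| + 1)) ≤ κ₁ := by
      rw [mul_div_assoc']
      rw [div_le_iff₀ (by positivity)]
      nlinarith [abs_nonneg Λ]
    exact h2.trans h3
  refine ⟨κ₁, hκ₁0, c₂, hc₂0, lt_of_le_of_lt hc₂1 (by norm_num), ?_⟩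
  intro U P G hsw hG hI hD hrate hsing
  -- ### the smooth strip representative and its class-uniform bounds
  have hP : ∀ z₀ : ℝ × EuclideanSpace ℝ (Fin 3), z₀.1 ≤ 0 →
      ∫⁻ q in parabolicCylinder 1 z₀, ‖P q.1 q.2‖ₑ ^ (3 / 2 : ℝ) ≤ D₀ := by
    intro z₀ hz₀
    have h := hD z₀ hz₀ 1 one_pos
    simpa [cknD] using h
  obtain ⟨-, Vs, hVsU, hVsc, hCD, hjc, -, hsol, -, -, -⟩ :=
    exists_strip_representative_of_apex hsw hD hrate (a := -2) (b := (-1 / 4 : ℝ)) (by norm_num)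
  have hbd : ∀ᵐ z ∂(volume.restrict (Ioo ((-2 : ℝ) - 1) (-1 / 4) ×ˢ
      (univ : Set (EuclideanSpace ℝ (Fin 3))))), ‖U z.1 z.2‖ ≤ L :=
    ae_norm_le_strip_of_rate hsw hrate (by norm_num)
  have hK : ∀ n ≤ 4, ∀ z ∈ Ioo (-2 : ℝ) (-1 / 4) ×ˢ (univ : Set (EuclideanSpace ℝ (Fin 3))),
      ‖iteratedFDeriv ℝ n (Vs z.1) z.2‖ ≤ K :=
    hKunif U P (-2) (-1 / 4) (by norm_num) hsw hP hbd Vs hVsU hVsc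
  set S : Set (ℝ × EuclideanSpace ℝ (Fin 3)) :=
    Ioo (-2 : ℝ) (-1 / 4) ×ˢ (univ : Set (EuclideanSpace ℝ (Fin 3))) with hSdef
  have hOS : O ⊆ S := prod_mono (Ioo_subset_Ioo (by norm_num) (by norm_num)) (subset_univ _)
  have hK0 : 0 ≤ K := (norm_nonneg _).trans (hK 0 (by norm_num) ((-1 : ℝ), 0) ⟨by norm_num, mem_univ _⟩)
  have hsmooth : ∀ s ∈ Ioo (-2 : ℝ) (-1 / 4), ContDiff ℝ (⊤ : ℕ∞) (Vs s) := fun s hs =>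
    contDiff_iff_contDiffAt.2 fun y => hCD (s, y) ⟨hs, mem_univ _⟩
  have hωbd : ∀ z ∈ S, ‖curl (Vs z.1) z.2‖ ≤ ‖curlCLM‖ * K := fun z hz => by
    have h := hK 1 (by norm_num) z hz
    rw [norm_iteratedFDeriv_one] at h
    exact (norm_curl_le _ _).trans (mul_le_mul_of_nonneg_left h (norm_nonneg curlCLM))
  -- ### `G = D Vs` a.e. on the box, so the `L¹` floor is a floor for `curl Vs`
  have hfdc : ContinuousOn (fun z : ℝ × EuclideanSpace ℝ (Fin 3) => fderiv ℝ (Vs z.1) z.2) S :=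
    continuousOn_fderiv_of_continuousOn_iteratedFDeriv_one (hjc 1)
  have hOQ : O ⊆ parabolicCylinder 2 (0 : ℝ × EuclideanSpace ℝ (Fin 3)) := by
    rintro ⟨s, y⟩ ⟨hs, hy⟩
    rw [mem_parabolicCylinder]
    simp only [Prod.fst_zero, Prod.snd_zero, zero_sub, dist_zero_right]
    rw [mem_ball_zero_iff] at hy
    exact ⟨⟨by linarith [hs.1], by linarith [hs.2]⟩, by linarith⟩
  have hVgrad : HasWeakSpatialGradientOn ⟨O, hOo⟩ Vs (fun t x => fderiv ℝ (Vs t) x) :=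
    hasWeakSpatialGradientOn_of_hasFDerivAt (S := Ioo (-2 : ℝ) (-1 / 4)) (Q := ⟨O, hOo⟩) hOS hVsc hfdc
      fun t ht x => ((hCD (t, x) ⟨ht, mem_univ _⟩).differentiableAt (by simp)).hasFDerivAt
  have hGO : HasWeakSpatialGradientOn ⟨O, hOo⟩ Vs G := by
    refine ((hG 2 two_pos).mono fun z hz => hOQ hz).congr_ae ?_
    have h1 : uncurry Vs =ᵐ[volume.restrict O] uncurry U := ae_restrict_of_ae_restrict_of_subset hOS hVsU
    exact h1.symm
  have hae := HasWeakSpatialGradientOn.ae_eq hVgrad hGO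
  have hfloorVs : ENNReal.ofReal κ₀ ≤ ∫⁻ z in O, ‖curl (Vs z.1) z.2‖ₑ := by
    have h := hfloor U P G hsw hG hI hrate hsing
    refine h.trans (le_of_eq (lintegral_congr_ae ?_))
    filter_upwards [hae] with z hz
    rw [curl_eq_curlCLM, show fderiv ℝ (Vs z.1) z.2 = G z.1 z.2 from hz]
  -- ### the real `L¹` floor and the `L²` floor on the box
  set f : ℝ × EuclideanSpace ℝ (Fin 3) → ℝ := fun z => ‖curl (Vs z.1) z.2‖ with hfdef
  have hfc : ContinuousOn f O := by
    refine ContinuousOn.norm ?_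
    exact (curlCLM.continuous.comp_continuousOn (hfdc.mono hOS)).congr fun z _ => by
      simp only [comp_apply, curl_eq_curlCLM]
  have hfm : AEStronglyMeasurable f (volume.restrict O) := hfc.aestronglyMeasurable hOm
  have hfbd : ∀ z ∈ O, ‖f z‖ ≤ ‖curlCLM‖ * K := fun z hz => by
    rw [hfdef, Real.norm_eq_abs, abs_norm]; exact hωbd z (hOS hz)
  have hfi : IntegrableOn f O volume :=
    ⟨hfm, HasFiniteIntegral.restrict_of_bounded (C := ‖curlCLM‖ * K) hOvol
      ((ae_restrict_iff' hOm).2 (ae_of_all _ hfbd))⟩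
  have hf2i : IntegrableOn (fun z => f z ^ 2) O volume := by
    refine ⟨hfm.pow 2, HasFiniteIntegral.restrict_of_bounded (C := (‖curlCLM‖ * K) ^ 2) hOvol
      ((ae_restrict_iff' hOm).2 (ae_of_all _ fun z hz => ?_))⟩
    rw [Real.norm_eq_abs, abs_of_nonneg (by positivity)]
    exact pow_le_pow_left₀ (norm_nonneg _) (hωbd z (hOS hz)) 2
  have hL1 : κ₀ ≤ ∫ z in O, f z := by
    have h1 : ENNReal.ofReal (∫ z in O, f z) = ∫⁻ z in O, ‖curl (Vs z.1) z.2‖ₑ := by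
      rw [ofReal_integral_eq_lintegral_ofReal hfi (ae_of_all _ fun z => norm_nonneg _)]
      exact lintegral_congr fun z => by rw [hfdef, ofReal_norm]
    have h2 : ENNReal.ofReal κ₀ ≤ ENNReal.ofReal (∫ z in O, f z) := by rw [h1]; exact hfloorVs
    exact (ENNReal.ofReal_le_ofReal_iff (integral_nonneg fun z => norm_nonneg _)).1 h2
  have hL2 : κ₁ ≤ ∫ z in O, f z ^ 2 := by
    set lam : ℝ := κ₀ / vol with hlam
    have hpt : ∀ z, 2 * lam * f z - lam ^ 2 ≤ f z ^ 2 := fun z => by nlinarith [sq_nonneg (f z - lam)]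
    have hi1 : IntegrableOn (fun z => 2 * lam * f z - lam ^ 2) O volume :=
      (hfi.const_mul (2 * lam)).sub (integrableOn_const hOvol.ne)
    have hle := setIntegral_mono_on hi1 hf2i hOm fun z _ => hpt z
    have e1 : ∫ z in O, (2 * lam * f z - lam ^ 2) = 2 * lam * (∫ z in O, f z) - lam ^ 2 * vol := by
      rw [integral_sub (hfi.const_mul (2 * lam)) (integrableOn_const hOvol.ne), integral_const_mul,
        setIntegral_const, smul_eq_mul, hvoldef, Measure.real]
      ring
    rw [e1] at hle
    have e2 : κ₁ = 2 * lam * κ₀ - lam ^ 2 * vol := by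
      rw [hκ₁def, hlam]; field_simp; ring
    have h3 : 2 * lam * κ₀ ≤ 2 * lam * ∫ z in O, f z :=
      mul_le_mul_of_nonneg_left hL1 (by positivity)
    linarith
  -- ### Fubini: the space–time `L²` mass is the time integral of the ball enstrophy
  set E : ℝ → ℝ := fun t => ∫ x in ball (0 : EuclideanSpace ℝ (Fin 3)) 1, ‖curl (Vs t) x‖ ^ 2
    with hEdef
  have hfub : ∫ z in O, f z ^ 2 = ∫ t in Ioo (-1 : ℝ) (-1 / 2), E t := by
    have hf2i' : IntegrableOn (fun z : ℝ × EuclideanSpace ℝ (Fin 3) => f z ^ 2)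
        (Ioo (-1 : ℝ) (-1 / 2) ×ˢ ball (0 : EuclideanSpace ℝ (Fin 3)) 1)
        ((volume : Measure ℝ).prod (volume : Measure (EuclideanSpace ℝ (Fin 3)))) := by
      rw [← Measure.volume_eq_prod]; exact hf2i
    have h := setIntegral_prod (fun z : ℝ × EuclideanSpace ℝ (Fin 3) => f z ^ 2) hf2i'
    rw [← Measure.volume_eq_prod] at h
    rw [hOdef, h]
  -- ### the ball enstrophy is Lipschitz in time on the strip
  have hLip : ∀ t ∈ Ioo (-2 : ℝ) (-1 / 4), ∀ t' ∈ Ioo (-2 : ℝ) (-1 / 4), |E t - E t'| ≤ Λ * |t - t'| :=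
    fun t ht t' ht' => abs_enstrophy_sub_le hsol hCD hjc hK 0 1 ht ht'
  have hEc : ContinuousOn E (Icc (-1 : ℝ) (-1 / 2)) := by
    have hsub : Icc (-1 : ℝ) (-1 / 2) ⊆ Ioo (-2 : ℝ) (-1 / 4) := Icc_subset_Ioo (by norm_num) (by norm_num)
    refine Metric.continuousOn_iff.2 fun t ht ε hε => ⟨ε / (|Λ| + 1), by positivity, fun t' ht' hd => ?_⟩
    rw [Real.dist_eq] at hd ⊢
    calc |E t' - E t| ≤ Λ * |t' - t| := hLip t' (hsub ht') t (hsub ht)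
      _ ≤ |Λ| * |t' - t| := mul_le_mul_of_nonneg_right (le_abs_self Λ) (abs_nonneg _)
      _ < |Λ| * (ε / (|Λ| + 1)) + (ε / (|Λ| + 1)) := by
          nlinarith [abs_nonneg Λ, abs_nonneg (t' - t), mul_le_mul_of_nonneg_left hd.le (abs_nonneg Λ),
            div_pos hε (by positivity : (0:ℝ) < |Λ| + 1)]
      _ = ε := by field_simp
  -- ### a time of maximal enstrophy dominates the mean
  obtain ⟨tm, htm, hmax⟩ := (isCompact_Icc (a := (-1 : ℝ)) (b := -1 / 2)).exists_isMaxOn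
    (nonempty_Icc.2 (by norm_num)) hEc
  have hEint : IntegrableOn E (Ioo (-1 : ℝ) (-1 / 2)) volume :=
    (hEc.integrableOn_Icc (μ := volume)).mono_set Ioo_subset_Icc_self
  have hmean : ∫ t in Ioo (-1 : ℝ) (-1 / 2), E t ≤ (1 / 2) * E tm := by
    have h1 : ∫ t in Ioo (-1 : ℝ) (-1 / 2), E t ≤ ∫ t in Ioo (-1 : ℝ) (-1 / 2), E tm :=
      setIntegral_mono_on hEint (integrableOn_const measure_Ioo_lt_top.ne) measurableSet_Ioo
        fun t ht => hmax (Ioo_subset_Icc_self ht)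
    refine h1.trans (le_of_eq ?_)
    rw [setIntegral_const, smul_eq_mul, Measure.real, Real.volume_Ioo]
    norm_num
  have hEtm : 2 * κ₁ ≤ E tm := by
    have := hL2; rw [hfub] at this; linarith
  -- ### the interval `[tm - c₂, tm]`
  refine ⟨tm, htm, fun V hVU hVc t ht => ?_⟩
  have htS : t ∈ Ioo (-2 : ℝ) (-1 / 4) := ⟨by linarith [ht.1, htm.1], by linarith [ht.2, htm.2]⟩
  have htmS : tm ∈ Ioo (-2 : ℝ) (-1 / 4) := ⟨by linarith [htm.1], by linarith [htm.2]⟩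
  have hEt : κ₁ ≤ E t := by
    have h1 := hLip t htS tm htmS
    have h2 : |t - tm| ≤ c₂ := by rw [abs_sub_comm, abs_of_nonneg (by linarith [ht.2])]; linarith [ht.1]
    have h3 : |E t - E tm| ≤ κ₁ :=
      h1.trans ((mul_le_mul (le_abs_self Λ) h2 (abs_nonneg _) (abs_nonneg _)).trans hc₂Λ)
    have h4 := neg_le_of_abs_le h3
    linarith
  -- ### any continuous representative has the same slices on the strip
  have heqS : EqOn (uncurry V) (uncurry Vs) S :=
    Measure.eqOn_open_of_ae_eq (hVU.trans hVsU.symm) (isOpen_Ioo.prod isOpen_univ) hVc hVsc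
  have hslice : V t = Vs t := funext fun x => heqS (show ((t, x) : ℝ × EuclideanSpace ℝ (Fin 3)) ∈ S
    from ⟨htS, mem_univ _⟩)
  rw [hslice]
  exact hEt

end Summit.NavierStokesRegularity.NavierStokesRegularity.Theorems.TypeITraceScarL3

end
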